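import Mathlib
import Summits.NavierStokesRegularity.NavierStokesRegularity.Theorems.FilamentSkeletonRssStadiumStripCore
import Summits.NavierStokesRegularity.NavierStokesRegularity.Theorems.FilamentSkeletonRssStadiumConstants

/-!
# The RETYPED strip propagation, PROVED (`TangentSkeletonNearStraightL`, stmt-NavierStokesRegularity-23320, registered stub
# `stub_stripPropagation : StripPropagation` of line `child_tangent_analytic_strip_L` with ONE token changed: output half-width
# `cs·√Γ/4 ↦ cs·√Γ/16`)

`strip_propagation_sixteenth` below is the text of the registered stub statement `StripPropagation` (skeleton
`child_tangent_analytic_strip_L.lean`, sha256 b0b56c52900dd90a…, §3) with the line's predicates `Stadium`, `StadiumAnalyticCurve`,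
`StadiumAnalyticArea`, `StadiumAnalyticBdd`, `cplx` δ-unfolded (a line file is not importable from `Theorems/`) and the SINGLE
change `cs * √Γ / 4 ↦ cs * √Γ / 16` in the conclusion — the retype requested by hand fsrs-2-g2 (evidence
`DIAG-stripPropagation-ends-g2.md` + addenda on the item: at quarter width the end descents of the shifted contour have slope `≥ 1/3`
and leave the principal branch for every `Rb ≤ 1/2`; at ratio 16 they have slope `≤ 2/7` and the landed constants close).  Everything
analytic is the landed per-filament core `Theorems.StadiumStripCore.strip_core` (p821949); this file supplies ONLY what its docstring
lists as remaining: the instantiation `h := cs√Γ/16`, `L := Rb√(Γ log Γ)`, `d₀ := ρ√Γ`, the Γ-asymptotics of its explicit bound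
(`B_own + B_partner ≤ C₀(cs,ρ)·log Γ/√Γ`, `∑_k |Γγ_k/4π| ≤ NΓθ₀⁻¹/4π`, hence `B ≤ Cu·√Γ·log Γ` with
`Cu = Nθ₀⁻¹C₀/4π`), the plateau log-condition `√(κ/2Λ)/√A₁ ≤ 2(L+8h)` for `Γ ≥ Γ₀(cs, Λ)`, and the quantifier packaging.
If the planner retypes the stub (`/ 4 ↦ / 16`, one token; `stub_analyticClosingL` consumes `StripPropagation` only as a hypothesis),
the by-name closer is `theorem stub_stripPropagation : StripPropagation := strip_propagation_sixteenth` (definitional unfolding).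

HONEST FRAMING: bookkeeping for a HYPOTHETICAL filament skeleton on the NEGATIVE side of a MODEL route; the registered stub (quarter
width) is NOT proved here, `TangentSkeletonNearStraightL` / `SkeletonJ1L` stay OPEN, and nothing here bears on Navier–Stokes regularity
or blow-up.  `--supports stmt-NavierStokesRegularity-23320`.
-/

set_option linter.dupNamespace false

noncomputable section

namespace Summit.NavierStokesRegularity.NavierStokesRegularity.Theorems.StadiumStripPropagation

open Set MeasureTheory Complex
open scoped InnerProductSpace
open Literature.Analysis.FluidPDE
open Summit.NavierStokesRegularity.NavierStokesRegularity.Theorems.StadiumStripCore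
open Summit.NavierStokesRegularity.NavierStokesRegularity.Theorems.StadiumConstants

/-! ## §1  Real arithmetic: the two `3/2`-powers, the coefficient sum -/

/-- `x^{3/2} = x·√x` for `x ≥ 0`. [folklore] -/
theorem rpow_three_halves {x : ℝ} (hx : 0 ≤ x) : x ^ (3/2 : ℝ) = x * √x := by
  rw [show (3/2 : ℝ) = 1 + 1/2 by norm_num, Real.rpow_add' hx (by norm_num), Real.rpow_one, Real.sqrt_eq_rpow]

/-- `x^{-3/2} = (x·√x)⁻¹` for `x ≥ 0`. [folklore] -/
theorem rpow_neg_three_halves {x : ℝ} (hx : 0 ≤ x) : x ^ (-(3/2 : ℝ)) = (x * √x)⁻¹ := by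
  rw [Real.rpow_neg hx, rpow_three_halves hx]

/-- `A₁^{3/2} ≥ 16/25` at disc ratio 8, `M = 2`, `0 ≤ Rb ≤ 1/2` (from `A₁ ≥ 4/5`, Theorems.StadiumConstants). [folklore] -/
theorem A_rpow_ge {Rb : ℝ} (hRb0 : 0 ≤ Rb) (hRb : Rb ≤ 1 / 2) :
    16 / 25 ≤ (1 - (Rb + 2 * (√3 * (2 * 2 * (Real.log ((8:ℝ) / (8 - 1)) - 1 / 8)))) ^ 2 / 2) ^ (3/2 : ℝ) := by
  have hA := ratio8_A_ge hRb0 hRb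
  set A := 1 - (Rb + 2 * (√3 * (2 * 2 * (Real.log ((8:ℝ) / (8 - 1)) - 1 / 8)))) ^ 2 / 2 with hAdef
  have hA0 : 0 ≤ A := by linarith
  rw [rpow_three_halves hA0]
  have hs : 4 / 5 ≤ √A := (Real.le_sqrt' (by norm_num : (0:ℝ) < 4 / 5)).mpr (by nlinarith)
  nlinarith

/-- `√A₁ ≥ 4/5` at disc ratio 8, `M = 2`, `0 ≤ Rb ≤ 1/2`. [folklore] -/
theorem sqrtA_ge {Rb : ℝ} (hRb0 : 0 ≤ Rb) (hRb : Rb ≤ 1 / 2) :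
    4 / 5 ≤ √(1 - (Rb + 2 * (√3 * (2 * 2 * (Real.log ((8:ℝ) / (8 - 1)) - 1 / 8)))) ^ 2 / 2) :=
  (Real.le_sqrt' (by norm_num : (0:ℝ) < 4 / 5)).mpr (by nlinarith [ratio8_A_ge hRb0 hRb])

/-- The connector constant: `((7h)²·c_Q)^{-3/2} ≤ 2/(147 h³)` (from `c_Q ≥ 3/8`, Theorems.StadiumConstants). [folklore] -/
theorem Q_rpow_le {Rb h : ℝ} (hRb0 : 0 ≤ Rb) (hRb : Rb ≤ 1 / 2) (hh : 0 < h) :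
    ((7 * h) ^ 2 * ((1 - (2 / 7 : ℝ) ^ 2) * (1 - (Rb + 2 * (√3 * (2 * 2 * (Real.log ((8:ℝ) / (8 - 1)) - 1 / 8)))) ^ 2 / 2) -
      2 * (2 / 7 : ℝ) * (2 * (√3 * (2 * Real.log ((8:ℝ) / (8 - 1)))) *
        (Rb + 2 * (√3 * (2 * 2 * (Real.log ((8:ℝ) / (8 - 1)) - 1 / 8))))))) ^ (-(3/2 : ℝ)) ≤ 2 / (147 * h ^ 3) := by
  have hc := ratio8_slope_ge hRb0 hRb (by norm_num : (0:ℝ) ≤ 2 / 7) le_rfl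
  set cQ := (1 - (2 / 7 : ℝ) ^ 2) * (1 - (Rb + 2 * (√3 * (2 * 2 * (Real.log ((8:ℝ) / (8 - 1)) - 1 / 8)))) ^ 2 / 2) -
      2 * (2 / 7 : ℝ) * (2 * (√3 * (2 * Real.log ((8:ℝ) / (8 - 1)))) *
        (Rb + 2 * (√3 * (2 * 2 * (Real.log ((8:ℝ) / (8 - 1)) - 1 / 8))))) with hcQ
  have hlow : 147 / 8 * h ^ 2 ≤ (7 * h) ^ 2 * cQ := by nlinarith [mul_le_mul_of_nonneg_left hc (sq_nonneg (7 * h))]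
  have hQ0 : 0 ≤ (7 * h) ^ 2 * cQ := le_trans (by positivity) hlow
  rw [rpow_neg_three_halves hQ0, show (2 : ℝ) / (147 * h ^ 3) = (147 * h ^ 3 / 2)⁻¹ by rw [inv_div]]
  apply inv_anti₀ (by positivity)
  have h4 : 4 * h ≤ √((7 * h) ^ 2 * cQ) := (Real.le_sqrt' (by positivity : (0:ℝ) < 4 * h)).mpr (by nlinarith)
  calc 147 * h ^ 3 / 2 = (147 / 8 * h ^ 2) * (4 * h) := by ring
    _ ≤ ((7 * h) ^ 2 * cQ) * √((7 * h) ^ 2 * cQ) := mul_le_mul hlow h4 (by positivity) hQ0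

/-- The coefficient sum: `∑_k |Γγ_k/4π| ≤ N·Γθ₀⁻¹/4π` when `|γ_k| ≤ θ₀⁻¹`, `Γ ≥ 0`. [folklore] -/
theorem coeff_sum_le {N : ℕ} {Γ θ₀ : ℝ} {γ : Fin N → ℝ} (hΓ : 0 ≤ Γ) (hγ : ∀ k, |γ k| ≤ θ₀⁻¹) :
    ∑ k, |Γ * γ k / (4 * Real.pi)| ≤ N * (Γ * θ₀⁻¹ / (4 * Real.pi)) := by
  have hk : ∀ k, |Γ * γ k / (4 * Real.pi)| ≤ Γ * θ₀⁻¹ / (4 * Real.pi) := by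
    intro k
    rw [abs_div, abs_mul, abs_of_nonneg hΓ, abs_of_pos (by positivity : (0:ℝ) < 4 * Real.pi)]
    exact div_le_div_of_nonneg_right (mul_le_mul_of_nonneg_left (hγ k) hΓ) (by positivity)
  calc ∑ k, |Γ * γ k / (4 * Real.pi)| ≤ ∑ _k : Fin N, Γ * θ₀⁻¹ / (4 * Real.pi) := Finset.sum_le_sum fun k _ => hk k
    _ = N * (Γ * θ₀⁻¹ / (4 * Real.pi)) := by simp

/-! ## §2  The Γ-asymptotics of the explicit bound of `strip_core` -/

/-- Elementary facts at `log Γ ≥ 1`: `1 ≤ √Γ`, `√Γ ≤ Γ`, `√(log Γ) ≤ √Γ`, `√(log Γ) ≤ log Γ`, `1 ≤ √(log Γ)`,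
`√(Γ log Γ) = √Γ √(log Γ)`. [folklore] -/
theorem gamma_facts {Γ : ℝ} (hΓ1 : 1 ≤ Γ) (hℓ1 : 1 ≤ Real.log Γ) :
    1 ≤ √Γ ∧ √Γ ≤ Γ ∧ √(Real.log Γ) ≤ √Γ ∧ √(Real.log Γ) ≤ Real.log Γ ∧ 1 ≤ √(Real.log Γ) ∧
      √(Γ * Real.log Γ) = √Γ * √(Real.log Γ) := by
  have hΓ0 : 0 ≤ Γ := by linarith
  have hr1 : 1 ≤ √Γ := Real.one_le_sqrt.2 hΓ1
  have hrr : √Γ * √Γ = Γ := Real.mul_self_sqrt hΓ0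
  refine ⟨hr1, by nlinarith, Real.sqrt_le_sqrt (by linarith [Real.log_le_sub_one_of_pos (by linarith : (0:ℝ) < Γ)]),
    ?_, Real.one_le_sqrt.2 hℓ1, Real.sqrt_mul hΓ0 _⟩
  have h1 : 1 ≤ √(Real.log Γ) := Real.one_le_sqrt.2 hℓ1
  have h2 : √(Real.log Γ) * √(Real.log Γ) = Real.log Γ := Real.mul_self_sqrt (by linarith)
  nlinarith

/-- The explicit constant `C₀(cs, ρ)` of the asymptotics is positive. [folklore] -/
theorem C0_pos {cs ρ : ℝ} (hcs : 0 < cs) (hρ : 0 < ρ) :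
    0 < (30720 / 7) * (Real.pi / cs) + (800 / 7) * (1 / cs) + (8192 / 147) * (1 / cs ^ 2 + 1 / cs) +
      (78080 / 63) * (Real.pi / ρ) := by
  positivity

/-- **Γ-asymptotics of `B_own + B_partner`, abstract form.**  With `h = cs·r/16`, `L = Rb·r·s`, `d₀ = ρ·r` (`r = √Γ`,
`s = √(log Γ) ≤ ℓ = log Γ`), a lower bound `P ≥ 16/25` for `A₁^{3/2}`, an upper bound `Qr ≤ 2/(147h³)` for the connector power
and `1/3 + lg ≤ 2ℓ` for the plateau logarithm, the explicit per-unit-circulation bound of `strip_core` is `≤ C₀(cs,ρ)·ℓ/r`. [folklore] -/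
theorem bound_abstract {cs ρ Rb r s ℓ h L d₀ P Qr lg : ℝ} (hcs : 0 < cs) (hρ : 0 < ρ) (hRb0 : 0 ≤ Rb) (hRb : Rb ≤ 1 / 2)
    (hr1 : 1 ≤ r) (hℓ1 : 1 ≤ ℓ) (hs0 : 0 ≤ s) (hsℓ : s ≤ ℓ)
    (hh : h = cs * r / 16) (hL : L = Rb * (r * s)) (hd : d₀ = ρ * r)
    (hP : 16 / 25 ≤ P) (hQr : Qr ≤ 2 / (147 * h ^ 3)) (hlg : 1 / 3 + lg ≤ 2 * ℓ) :
    5 * 72 * (Real.pi / ((7 / 16) * (3 * h))) + 4 * (2 * (2 / (7 * h))) * ((1/3 + lg) / P) +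
        2 * (h * (Qr * (2 * 2 ^ 2 * (2 * L + 11 * h)))) + 5 * (61 * 16 / 9) * (Real.pi / ((7 / 16) * d₀)) ≤
      ((30720 / 7) * (Real.pi / cs) + (800 / 7) * (1 / cs) + (8192 / 147) * (1 / cs ^ 2 + 1 / cs) +
        (78080 / 63) * (Real.pi / ρ)) * (ℓ / r) := by
  have hr0 : 0 < r := by linarith
  have hℓ0 : 0 < ℓ := by linarith
  have hh0 : 0 < h := by rw [hh]; positivity
  have hL0 : 0 ≤ L := by rw [hL]; positivity
  have hd0 : 0 < d₀ := by rw [hd]; positivity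
  have hℓr : 1 / r ≤ ℓ / r := div_le_div_of_nonneg_right hℓ1 hr0.le
  -- T1
  have hT1 : 5 * 72 * (Real.pi / ((7 / 16) * (3 * h))) ≤ (30720 / 7) * (Real.pi / cs) * (ℓ / r) := by
    have e1 : 5 * 72 * (Real.pi / ((7 / 16) * (3 * h))) = (30720 / 7) * (Real.pi / cs) * (1 / r) := by
      rw [hh]; field_simp; ring
    rw [e1]
    exact mul_le_mul_of_nonneg_left hℓr (by positivity)
  -- T4
  have hT4 : 5 * (61 * 16 / 9) * (Real.pi / ((7 / 16) * d₀)) ≤ (78080 / 63) * (Real.pi / ρ) * (ℓ / r) := by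
    have e4 : 5 * (61 * 16 / 9) * (Real.pi / ((7 / 16) * d₀)) = (78080 / 63) * (Real.pi / ρ) * (1 / r) := by
      rw [hd]; field_simp; ring
    rw [e4]
    exact mul_le_mul_of_nonneg_left hℓr (by positivity)
  -- T2
  have hT2 : 4 * (2 * (2 / (7 * h))) * ((1/3 + lg) / P) ≤ (800 / 7) * (1 / cs) * (ℓ / r) := by
    have hP0 : 0 < P := by linarith
    have hq : (1/3 + lg) / P ≤ (25 / 8) * ℓ := by
      calc (1/3 + lg) / P ≤ (2 * ℓ) / P := div_le_div_of_nonneg_right hlg hP0.le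
        _ ≤ (2 * ℓ) / (16 / 25) := div_le_div_of_nonneg_left (by positivity) (by norm_num) hP
        _ = (25 / 8) * ℓ := by ring
    have hpre : 4 * (2 * (2 / (7 * h))) = (256 / 7) * (1 / cs) * (1 / r) := by rw [hh]; field_simp; ring
    calc 4 * (2 * (2 / (7 * h))) * ((1/3 + lg) / P) ≤ 4 * (2 * (2 / (7 * h))) * ((25 / 8) * ℓ) :=
          mul_le_mul_of_nonneg_left hq (by positivity)
      _ = (800 / 7) * (1 / cs) * (ℓ / r) := by rw [hpre]; ring
  -- T3
  have hT3 : 2 * (h * (Qr * (2 * 2 ^ 2 * (2 * L + 11 * h)))) ≤ (8192 / 147) * (1 / cs ^ 2 + 1 / cs) * (ℓ / r) := by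
    have hX0 : 0 ≤ 2 * 2 ^ 2 * (2 * L + 11 * h) := by positivity
    have step1 : Qr * (2 * 2 ^ 2 * (2 * L + 11 * h)) ≤ 2 / (147 * h ^ 3) * (2 * 2 ^ 2 * (2 * L + 11 * h)) :=
      mul_le_mul_of_nonneg_right hQr hX0
    have step2 : 2 * (h * (Qr * (2 * 2 ^ 2 * (2 * L + 11 * h)))) ≤
        2 * (h * (2 / (147 * h ^ 3) * (2 * 2 ^ 2 * (2 * L + 11 * h)))) :=
      mul_le_mul_of_nonneg_left (mul_le_mul_of_nonneg_left step1 hh0.le) (by norm_num)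
    have e3 : 2 * (h * (2 / (147 * h ^ 3) * (2 * 2 ^ 2 * (2 * L + 11 * h)))) =
        (8192 / 147) * ((2 * Rb * s + 11 / 16 * cs) / (cs ^ 2 * r)) := by
      rw [hL, hh]; field_simp; ring
    have e3' : (8192 / 147) * (1 / cs ^ 2 + 1 / cs) * (ℓ / r) = (8192 / 147) * ((ℓ + cs * ℓ) / (cs ^ 2 * r)) := by
      field_simp
    have hcmp : 2 * Rb * s + 11 / 16 * cs ≤ ℓ + cs * ℓ := by
      have ha : (0:ℝ) ≤ 1 - 2 * Rb := by linarith
      have hb : (0:ℝ) ≤ ℓ - 1 := by linarith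
      nlinarith [mul_nonneg ha hs0, mul_nonneg hcs.le hb]
    rw [e3']
    refine step2.trans ?_
    rw [e3]
    exact mul_le_mul_of_nonneg_left (div_le_div_of_nonneg_right hcmp (by positivity)) (by norm_num)
  have hsum := add_le_add (add_le_add (add_le_add hT1 hT2) hT3) hT4
  refine hsum.trans (le_of_eq ?_)
  ring

/-- The plateau logarithm: with `D = 2Rb·√Γ·√(log Γ) + cs·√Γ` and `log Γ ≥ 1/3 + log(1+cs) + |log √(κ/2Λ)|`,
`1/3 + log(D·√A₁/√(κ/2Λ)) ≤ 2 log Γ`. [folklore] -/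
theorem log_term_le {Rb Λ cs Γ D : ℝ} (hRb0 : 0 ≤ Rb) (hRb : Rb ≤ 1 / 2) (hΛ : 0 < Λ) (hcs : 0 < cs)
    (hΓ1 : 1 ≤ Γ) (hℓ1 : 1 ≤ Real.log Γ)
    (hℓC : 1 / 3 + Real.log (1 + cs) +
      |Real.log (√(Real.exp (-(1 + Real.eulerMascheroniConstant - Real.log 2)) / (2 * Λ)))| ≤ Real.log Γ)
    (hD : D = 2 * Rb * (√Γ * √(Real.log Γ)) + cs * √Γ) :
    1/3 + Real.log (D * √(1 - (Rb + 2 * (√3 * (2 * 2 * (Real.log ((8:ℝ) / (8 - 1)) - 1 / 8)))) ^ 2 / 2) /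
      √(Real.exp (-(1 + Real.eulerMascheroniConstant - Real.log 2)) / (2 * Λ))) ≤ 2 * Real.log Γ := by
  obtain ⟨hr1, hrΓ, hℓr, -, -, -⟩ := gamma_facts hΓ1 hℓ1
  have hΓ0 : 0 ≤ Γ := by linarith
  have hrr : √Γ * √Γ = Γ := Real.mul_self_sqrt hΓ0
  set m := √(Real.exp (-(1 + Real.eulerMascheroniConstant - Real.log 2)) / (2 * Λ)) with hmdef
  have hm0 : 0 < m := Real.sqrt_pos.mpr (by positivity)
  have hA := ratio8_A_ge hRb0 hRb
  set A₁ := 1 - (Rb + 2 * (√3 * (2 * 2 * (Real.log ((8:ℝ) / (8 - 1)) - 1 / 8)))) ^ 2 / 2 with hA₁def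
  have hA1 : A₁ ≤ 1 := by
    have : 0 ≤ (Rb + 2 * (√3 * (2 * 2 * (Real.log ((8:ℝ) / (8 - 1)) - 1 / 8)))) ^ 2 := sq_nonneg _
    rw [hA₁def]; linarith
  have hs1 : √A₁ ≤ 1 := Real.sqrt_le_one.2 hA1
  have hs0 : 0 < √A₁ := Real.sqrt_pos.mpr (by linarith)
  have hD0 : 0 < D := by rw [hD]; positivity
  have hDΓ : D ≤ (1 + cs) * Γ := by
    rw [hD]
    have h1 : √Γ * √(Real.log Γ) ≤ Γ := by nlinarith [Real.sqrt_nonneg (Real.log Γ), Real.sqrt_nonneg Γ]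
    have h2 : cs * √Γ ≤ cs * Γ := mul_le_mul_of_nonneg_left hrΓ hcs.le
    nlinarith
  have hlog1 : Real.log (D * √A₁ / m) ≤ Real.log (D / m) :=
    Real.log_le_log (div_pos (mul_pos hD0 hs0) hm0) (div_le_div_of_nonneg_right (mul_le_of_le_one_right hD0.le hs1) hm0.le)
  have hlog2 : Real.log (D / m) = Real.log D - Real.log m := Real.log_div hD0.ne' hm0.ne'
  have hlog3 : Real.log D ≤ Real.log (1 + cs) + Real.log Γ := by
    have := Real.log_le_log hD0 hDΓ
    rwa [Real.log_mul (by positivity) (by positivity)] at this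
  have hlog4 : -Real.log m ≤ |Real.log m| := neg_le_abs _
  linarith

/-- The plateau log-condition of `strip_core` (`√(κ/2Λ)/√A₁ ≤ 2(L + 8h)`) holds once `√Γ ≥ 5√(κ/2Λ)/(4cs)`. [folklore] -/
theorem plateau_condition {Rb Λ cs Γ D : ℝ} (hRb0 : 0 ≤ Rb) (hRb : Rb ≤ 1 / 2) (hΛ : 0 < Λ) (hcs : 0 < cs)
    (hr : 5 * √(Real.exp (-(1 + Real.eulerMascheroniConstant - Real.log 2)) / (2 * Λ)) / (4 * cs) ≤ √Γ)
    (hD : D = 2 * Rb * (√Γ * √(Real.log Γ)) + cs * √Γ) :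
    √(Real.exp (-(1 + Real.eulerMascheroniConstant - Real.log 2)) / (2 * Λ)) /
        √(1 - (Rb + 2 * (√3 * (2 * 2 * (Real.log ((8:ℝ) / (8 - 1)) - 1 / 8)))) ^ 2 / 2) ≤ D := by
  set m := √(Real.exp (-(1 + Real.eulerMascheroniConstant - Real.log 2)) / (2 * Λ)) with hmdef
  have hm0 : 0 < m := Real.sqrt_pos.mpr (by positivity)
  have hs := sqrtA_ge hRb0 hRb
  rw [hD]
  have h1 : m / √(1 - (Rb + 2 * (√3 * (2 * 2 * (Real.log ((8:ℝ) / (8 - 1)) - 1 / 8)))) ^ 2 / 2) ≤ m / (4 / 5) :=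
    div_le_div_of_nonneg_left hm0.le (by norm_num) hs
  have h2 : m / (4 / 5) ≤ cs * √Γ := by
    rw [div_le_iff₀ (by positivity : (0:ℝ) < 4 * cs)] at hr
    have : m / (4 / 5) = 5 * m / 4 := by ring
    rw [this]; linarith
  have h3 : 0 ≤ 2 * Rb * (√Γ * √(Real.log Γ)) := by positivity
  linarith

/-! ## §3  The retyped stub, proved -/

/-- **STRIP PROPAGATION at ratio 16 (the RETYPED stub P2 of line `child_tangent_analytic_strip_L`, stmt-23320).**  Along an `N`-tuple
of unit-speed, near-straight (tangent oscillation `≤ Rb ≤ 1/2`), `ρ√Γ`-separated, chord-arc filaments with core areas in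
`[Λ⁻¹, KA(1+Γ+‖X‖²)]`, each stadium-analytic of half-width `cs√Γ` (`8cs ≤ ρ`) around its ball segment together with its core area,
the matched Biot–Savart centreline field `τ ↦ u X (X j τ)` is stadium-analytic on the SIXTEENTH-width stadium with the Γ-uniform bound
`Cu·√Γ·log Γ`.  The registered text `StripPropagation` with `Stadium`/`StadiumAnalyticCurve`/`StadiumAnalyticArea`/`StadiumAnalyticBdd`/
`cplx` unfolded and `cs * √Γ / 4 ↦ cs * √Γ / 16`; proof = `Theorems.StadiumStripCore.strip_core` + §1–§2. [folklore] -/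
theorem strip_propagation_sixteenth :
    ∀ (N : ℕ) (ρ K Λ Rb cg θ₀ KA cs : ℝ), 0 < N → 0 < ρ → 0 < Λ → 0 < Rb → Rb ≤ 1/2 → 0 < cg → 0 < θ₀ → 0 < KA →
    0 < cs → 8 * cs ≤ ρ →
    ∃ (Cu Γ₀ : ℝ), 0 < Cu ∧ ∀ Γ : ℝ, Γ₀ ≤ Γ →
      ∀ (γ : Fin N → ℝ) (X : Fin N → ℝ → EuclideanSpace ℝ (Fin 3)) (c : Fin N → ℝ) (Aa : Fin N → ℝ → ℝ)
        (u : (Fin N → ℝ → EuclideanSpace ℝ (Fin 3)) → EuclideanSpace ℝ (Fin 3) → EuclideanSpace ℝ (Fin 3)),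
        (∀ Z y, u Z y = ∑ k, (Γ*γ k/(4*Real.pi))•∫ σ:ℝ, ((‖y-Z k σ‖^2+Real.exp (-(1+Real.eulerMascheroniConstant-Real.log 2))*Aa k σ)^(3/2:ℝ))⁻¹•cross (deriv (Z k) σ) (y-Z k σ)) →
        (∀ j, |γ j| ≤ θ₀⁻¹) →
        (∀ j, ContDiff ℝ 2 (X j) ∧ (∀ τ, ‖deriv (X j) τ‖ = 1) ∧ (∀ τ, ‖iteratedDeriv 2 (X j) τ‖ * √Γ ≤ K) ∧
          ∀ τ σ, ‖deriv (X j) τ - deriv (X j) σ‖ ≤ Rb) →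
        (∀ j k, j ≠ k → ∀ τ σ, ρ * √Γ ≤ ‖X j τ - X k σ‖) →
        (∀ j τ σ, ρ * √Γ ≤ |τ - σ| → cg * ρ * √Γ ≤ ‖X j τ - X j σ‖) →
        (∀ j, Differentiable ℝ (Aa j) ∧ (∀ τ, Λ⁻¹ ≤ Aa j τ) ∧ ∀ τ, Aa j τ ≤ KA * (1 + Γ + ‖X j τ‖ ^ 2)) →
        (∀ j, ∃ F : ℂ → (Fin 3 → ℂ),
          DifferentiableOn ℂ F {z : ℂ | |z.im| < cs * √Γ ∧ |z.re - c j| < Rb * √(Γ * Real.log Γ) + cs * √Γ} ∧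
          (∀ t : ℝ, (t : ℂ) ∈ {z : ℂ | |z.im| < cs * √Γ ∧ |z.re - c j| < Rb * √(Γ * Real.log Γ) + cs * √Γ} →
            F t = fun i => ((⟪X j t, EuclideanSpace.single i (1:ℝ)⟫_ℝ : ℝ) : ℂ)) ∧
          ∀ z ∈ {z : ℂ | |z.im| < cs * √Γ ∧ |z.re - c j| < Rb * √(Γ * Real.log Γ) + cs * √Γ}, ‖deriv F z‖ ≤ 2) →
        (∀ j, ∃ G : ℂ → ℂ,
          DifferentiableOn ℂ G {z : ℂ | |z.im| < cs * √Γ ∧ |z.re - c j| < Rb * √(Γ * Real.log Γ) + cs * √Γ} ∧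
          (∀ t : ℝ, (t : ℂ) ∈ {z : ℂ | |z.im| < cs * √Γ ∧ |z.re - c j| < Rb * √(Γ * Real.log Γ) + cs * √Γ} →
            G t = ((Aa j t : ℝ) : ℂ)) ∧
          ∀ z ∈ {z : ℂ | |z.im| < cs * √Γ ∧ |z.re - c j| < Rb * √(Γ * Real.log Γ) + cs * √Γ},
            Aa j z.re / 2 ≤ (G z).re ∧ ‖G z‖ ≤ 2 * Aa j z.re) →
        ∀ j, ∃ U : ℂ → (Fin 3 → ℂ),
          DifferentiableOn ℂ U {z : ℂ | |z.im| < cs * √Γ / 16 ∧ |z.re - c j| < Rb * √(Γ * Real.log Γ) + cs * √Γ / 16} ∧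
          (∀ t : ℝ, (t : ℂ) ∈ {z : ℂ | |z.im| < cs * √Γ / 16 ∧ |z.re - c j| < Rb * √(Γ * Real.log Γ) + cs * √Γ / 16} →
            U t = fun i => ((⟪u X (X j t), EuclideanSpace.single i (1:ℝ)⟫_ℝ : ℝ) : ℂ)) ∧
          ∀ z ∈ {z : ℂ | |z.im| < cs * √Γ / 16 ∧ |z.re - c j| < Rb * √(Γ * Real.log Γ) + cs * √Γ / 16},
            ‖U z‖ ≤ Cu * √Γ * Real.log Γ := by
  intro N ρ K Λ Rb cg θ₀ KA cs hN hρ hΛ hRb hRb2 hcg hθ hKA hcs h8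
  -- the constants
  set m : ℝ := √(Real.exp (-(1 + Real.eulerMascheroniConstant - Real.log 2)) / (2 * Λ)) with hmdef
  set Cn : ℝ := 1 / 3 + Real.log (1 + cs) + |Real.log m| with hCn
  set C₀ : ℝ := (30720 / 7) * (Real.pi / cs) + (800 / 7) * (1 / cs) + (8192 / 147) * (1 / cs ^ 2 + 1 / cs) +
      (78080 / 63) * (Real.pi / ρ) with hC₀
  have hC₀pos : 0 < C₀ := C0_pos hcs hρ
  have hN' : (0:ℝ) < N := Nat.cast_pos.mpr hN
  set Cu : ℝ := (N : ℝ) * θ₀⁻¹ / (4 * Real.pi) * C₀ with hCu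
  have hCupos : 0 < Cu := mul_pos (div_pos (mul_pos hN' (inv_pos.mpr hθ)) (by positivity)) hC₀pos
  refine ⟨Cu, max (Real.exp (max 1 Cn)) ((max 1 (5 * m / (4 * cs))) ^ 2), hCupos, ?_⟩
  intro Γ hΓ γ X c Aa u hu hγ hX hsep hca hA hF hG j
  -- consequences of `Γ ≥ Γ₀`
  have hΓexp : Real.exp (max 1 Cn) ≤ Γ := le_trans (le_max_left _ _) hΓ
  have hΓsq : (max 1 (5 * m / (4 * cs))) ^ 2 ≤ Γ := le_trans (le_max_right _ _) hΓ
  have hΓpos : 0 < Γ := lt_of_lt_of_le (Real.exp_pos _) hΓexp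
  have hΓ1 : 1 ≤ Γ := by
    have h1 : (1:ℝ) + 1 ≤ Real.exp 1 := Real.add_one_le_exp 1
    have h2 : Real.exp 1 ≤ Real.exp (max 1 Cn) := Real.exp_le_exp.mpr (le_max_left _ _)
    linarith
  have hℓ : max 1 Cn ≤ Real.log Γ := by
    rw [Real.le_log_iff_exp_le hΓpos]; exact hΓexp
  have hℓ1 : 1 ≤ Real.log Γ := le_trans (le_max_left _ _) hℓ
  have hℓC : Cn ≤ Real.log Γ := le_trans (le_max_right _ _) hℓ
  have hr : max 1 (5 * m / (4 * cs)) ≤ √Γ := by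
    have := Real.sqrt_le_sqrt hΓsq
    rwa [Real.sqrt_sq (le_trans zero_le_one (le_max_left _ _))] at this
  have hr5 : 5 * m / (4 * cs) ≤ √Γ := le_trans (le_max_right _ _) hr
  have hsΓ : 0 < √Γ := Real.sqrt_pos.mpr hΓpos
  obtain ⟨hr1, -, -, hsℓℓ, -, hsplit⟩ := gamma_facts hΓ1 hℓ1
  -- the retype geometry
  have hh : 0 < cs * √Γ / 16 := by positivity
  have h16 : 16 * (cs * √Γ / 16) ≤ cs * √Γ := le_of_eq (by ring)
  have hcsρ : cs ≤ ρ := by linarith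
  have h16d : 16 * (cs * √Γ / 16) ≤ ρ * √Γ := by
    have := mul_le_mul_of_nonneg_right hcsρ hsΓ.le
    linarith
  have hL : 0 < Rb * √(Γ * Real.log Γ) := mul_pos hRb (Real.sqrt_pos.mpr (mul_pos hΓpos (by linarith)))
  have hd₀ : 0 < ρ * √Γ := by positivity
  have hD : (c j + (Rb * √(Γ * Real.log Γ) + 8 * (cs * √Γ / 16))) - (c j - (Rb * √(Γ * Real.log Γ) + 8 * (cs * √Γ / 16))) =
      2 * Rb * (√Γ * √(Real.log Γ)) + cs * √Γ := by
    rw [hsplit]; ring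
  have hR := plateau_condition hRb.le hRb2 hΛ hcs hr5 hD
  obtain ⟨F, hF1, hF2, hF3⟩ := hF j
  obtain ⟨G, hG1, hG2, hG3⟩ := hG j
  obtain ⟨U, hU1, hU2, hU3⟩ := strip_core (hs := cs * √Γ) (h := cs * √Γ / 16) (L := Rb * √(Γ * Real.log Γ)) (d₀ := ρ * √Γ)
    (Γ := Γ) (γ := γ) (X := X) (c := c) (Aa := Aa) (u := u) j (F := F) (G := G) hu (fun k => (hX k).1) (fun k => (hX k).2.1)
    hRb.le hRb2 (fun k => (hX k).2.2.2) (fun k => (hA k).1) hΛ (fun k => (hA k).2.1) hd₀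
    (fun k hk τ σ => hsep j k (Ne.symm hk) τ σ) hF1 hF3 hF2 hG1 (fun w hw => (hG3 w hw).1) hG2 hh h16 hL h16d hR
  refine ⟨U, hU1, hU2, fun z hz => (hU3 z hz).trans ?_⟩
  -- the Γ-asymptotics of the explicit bound
  have h1 := coeff_sum_le (N := N) (γ := γ) (θ₀ := θ₀) hΓpos.le hγ
  have hlg := log_term_le hRb.le hRb2 hΛ hcs hΓ1 hℓ1 hℓC hD
  have hP := A_rpow_ge hRb.le hRb2
  have hQr := Q_rpow_le hRb.le hRb2 hh
  have hLeq : Rb * √(Γ * Real.log Γ) = Rb * (√Γ * √(Real.log Γ)) := by rw [hsplit]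
  have h2 := bound_abstract hcs hρ hRb.le hRb2 hr1 hℓ1 (Real.sqrt_nonneg _) hsℓℓ
    (rfl : cs * √Γ / 16 = cs * √Γ / 16) hLeq (rfl : ρ * √Γ = ρ * √Γ) hP hQr hlg
  have hS0 : 0 ≤ ∑ k, |Γ * γ k / (4 * Real.pi)| := Finset.sum_nonneg fun k _ => abs_nonneg _
  have hC₀ℓ : 0 ≤ C₀ * (Real.log Γ / √Γ) := mul_nonneg hC₀pos.le (div_nonneg (by linarith) hsΓ.le)
  have key : Γ * (Real.log Γ / √Γ) = √Γ * Real.log Γ := by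
    rw [mul_div_left_comm, Real.div_sqrt, mul_comm]
  have h4 : (∑ k, |Γ * γ k / (4 * Real.pi)|) * (C₀ * (Real.log Γ / √Γ)) ≤ Cu * √Γ * Real.log Γ := by
    refine (mul_le_mul_of_nonneg_right h1 hC₀ℓ).trans (le_of_eq ?_)
    have e : (N : ℝ) * (Γ * θ₀⁻¹ / (4 * Real.pi)) * (C₀ * (Real.log Γ / √Γ)) =
        (N : ℝ) * θ₀⁻¹ / (4 * Real.pi) * C₀ * (Γ * (Real.log Γ / √Γ)) := by ring
    rw [e, key, hCu]; ring
  exact (mul_le_mul_of_nonneg_left h2 hS0).trans h4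

end Summit.NavierStokesRegularity.NavierStokesRegularity.Theorems.StadiumStripPropagation

end
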